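import Mathlib.Combinatorics.SimpleGraph.Maps
import Literature.Computability.MetaComplexity.SOSThreeColouring
import Literature.Computability.MetaComplexity.XorPseudoexpectation
import Literature.Computability.MetaComplexity.RandomCNFResolutionProofs
import Literature.Computability.MetaComplexity.SumOfSquaresProofs
import HarnessLib

/-!
# Proof of the linear-degree SOS lower bound for 3-colourability
(`SOSThreeColLinearLowerBound_holds`)

DISCHARGE of the named fact `SOSThreeColLinearLowerBound` (`SOSThreeColouring.lean`;
Thapper–Živný 2018, §3.3 Thm. 2 with Def. 12, for the crisp template `K₃`; Atserias–Ochremiak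
2019, Cor. 5 (4)).

We follow the architecture of the published proofs — a Boolean base case plus ONE gadget
reduction whose Lasserre/SOS solutions are pushed forward (Thapper–Živný 2018, §4: Thm. 3 and the
remark after it crediting the Boolean case to Grigoriev 2001 / Schoenebeck 2008, Def. 13
"reductions preserve linear levels"; Atserias–Ochremiak 2019, §8.1–8.2: 3-SAT → 3-COLOURING by
the textbook gadgets, SOS degree is preserved up to a constant factor under such local
interpretations) — with the base case the tree already PROVES:

1. `exists_unsat_expanding` — for all large `n` there is an UNSATISFIABLE 3-CNF with `6n` clauses
   over `n` variables whose scope family is a cover expander at the linear radius `⌊κn⌋`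
   (first-moment counts `card_le_of_forall_satisfiable`,
   `card_le_of_forall_not_isCoverExpander_linear` of `RandomCNFFirstMoment.lean`, as assembled in
   `chvatal_szemeredi_holds`; Chvátal–Szemerédi 1988).
2. The Grigoriev–Schoenebeck moment functional `L = momentFunctional (pseudoMoment …)` of such a
   formula (`XorPseudoexpectation.lean`, `XorDerivation.lean`: normalisation, positivity
   `pseudoMoment_quadratic_nonneg`, clause identities `momentFunctional_phi_unsatPoly_mul`).
3. `threeColPseudoexpectation_of_local` — the PUSHFORWARD: if every colour indicator `y_{w,a}` of a
   graph is interpreted by an element `P w a` of the parity algebra `ℝ[ParityVec]` supported on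
   `≤ s` variables, the `P w ·` being orthogonal idempotents, orthogonal along edges, and summing
   to `1` or to `1 - phi (unsatPoly C)` for a clause `C` of the formula, then
   `L ∘ aeval P` is a degree-`d` pseudoexpectation for the 3-colouring system whenever
   `s d + s ≤ D` (`D` the XOR degree). This is the SOS half of "reductions preserve levels"
   (Thapper–Živný Def. 13 / Lemma 5; Atserias–Ochremiak Thm. 7) for this one interpretation.
4. The textbook 3-SAT → 3-COLOURING gadget graph `gadGraph` (special triangle `T, F, B`; a
   vertex per literal; per clause two chained OR-gadgets whose output is joined to `F` and `B` —
   Garey–Johnson–Stockmeyer 1976 / CLRS §34.5), its canonical local colourings `gadCol`, the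
   interpretation `gadP` by local functions of the clause's three literal values (orthogonal
   idempotents `eLoc`), and `satisfiable_of_colorable`.
5. Assembly with isolated padding vertices to hit every large vertex count exactly.

## References

* J. Thapper, S. Živný, *The limits of SDP relaxations for general-valued CSPs*, ACM ToCT 10(3)
  (2018), arXiv:1612.01147: Def. 11–13, §3.3 Thm. 2, §4 Thm. 3 and the paragraph after it.
* A. Atserias, J. Ochremiak, *Proof complexity meets algebra*, ACM ToCL 20(1) (2019),
  arXiv:1711.07320: §6.4, Thm. 7, §8.1 Cor. 5, §8.2.
* D. Grigoriev, TCS 259 (2001) 613–622; G. Schoenebeck, FOCS 2008 (the Boolean base case).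
* V. Chvátal, E. Szemerédi, J. ACM 35 (1988), §1 and Lemma 1 (unsatisfiable expanding formulas).
* M. R. Garey, D. S. Johnson, L. Stockmeyer, *Some simplified NP-complete graph problems*,
  TCS 1 (1976) 237–267, Thm. 2.2 (3-SAT ≤ 3-COLOURING gadgets).
-/

noncomputable section

open Finset MvPolynomial Filter Literature.Computability.Complexity

namespace Literature.Computability.MetaComplexity

namespace ThreeColGadget

/-! ### Local calculus in the parity algebra: literal indicators -/

/-- The indicator of `x_v = b` in the parity algebra: `(1 - y_v)/2` for `b = true`,
`(1 + y_v)/2` for `b = false`. [Grigoriev 2001, §2] [folklore] -/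
def ind (v : ℕ) : Bool → ParityAlg
  | true => phiX v
  | false => 1 - phiX v

/-- `ind v b` is idempotent. [folklore] -/
theorem ind_mul_self (v : ℕ) : ∀ b : Bool, ind v b * ind v b = ind v b
  | true => phiX_mul_self v
  | false => by
    have h := phiX_mul_self v
    show (1 - phiX v) * (1 - phiX v) = 1 - phiX v
    linear_combination h

/-- `ind v b · ind v (¬b) = 0`. [folklore] -/
theorem ind_mul_not (v : ℕ) : ∀ b : Bool, ind v b * ind v (!b) = 0
  | true => by
    have h := phiX_mul_self v
    show phiX v * (1 - phiX v) = 0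
    linear_combination (-1 : ParityAlg) * h
  | false => by
    have h := phiX_mul_self v
    show (1 - phiX v) * phiX v = 0
    linear_combination (-1 : ParityAlg) * h

/-- Distinct values are orthogonal. [folklore] -/
theorem ind_mul_of_ne (v : ℕ) {b b' : Bool} (h : b ≠ b') : ind v b * ind v b' = 0 := by
  have : b' = !b := by cases b <;> cases b' <;> simp_all
  rw [this]
  exact ind_mul_not v b

/-- `ind v true + ind v false = 1`. [folklore] -/
theorem ind_add (v : ℕ) : ind v true + ind v false = 1 := by
  show phiX v + (1 - phiX v) = 1
  abel

/-- `ind v b` only involves the variable `v`. [folklore] -/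
theorem suppIn_ind (v : ℕ) : ∀ b : Bool, SuppIn {v} (ind v b)
  | true => suppIn_phiX v
  | false => (suppIn_one _).sub (suppIn_phiX v)

/-- The indicator that the literal `l` has truth value `t` (`(v, b)` is true iff `x_v = b`).
[folklore] -/
def litInd (l : Literal ℕ) : Bool → ParityAlg
  | true => ind l.1 l.2
  | false => ind l.1 (!l.2)

/-- The arithmetised falsity polynomial of a literal is its falsity indicator. [folklore] -/
theorem phi_litFalsePoly_eq (l : Literal ℕ) : phi (litFalsePoly l) = litInd l false := by
  rcases l with ⟨v, _ | _⟩
  · simp only [litFalsePoly, Bool.false_eq_true, if_false, phi_X]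
    rfl
  · simp only [litFalsePoly, if_true, map_sub, map_one, phi_X]
    rfl

/-- `litInd l t · litInd l t' = [t = t'] litInd l t`. [folklore] -/
theorem litInd_mul_litInd (l : Literal ℕ) (t t' : Bool) :
    litInd l t * litInd l t' = if t = t' then litInd l t else 0 := by
  rcases t with _ | _ <;> rcases t' with _ | _
  · exact ind_mul_self _ _
  · simp only [Bool.false_eq_true, if_false]
    show ind l.1 (!l.2) * ind l.1 l.2 = 0
    rw [mul_comm]; exact ind_mul_not _ _
  · simp only [Bool.true_eq_false, if_false]
    exact ind_mul_not _ _
  · exact ind_mul_self _ _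

/-- `litInd l true + litInd l false = 1`. [folklore] -/
theorem litInd_add (l : Literal ℕ) : litInd l true + litInd l false = 1 := by
  rcases l with ⟨v, _ | _⟩
  · show ind v false + ind v true = 1
    rw [add_comm]; exact ind_add v
  · exact ind_add v

/-- `litInd l t` only involves the variable of `l`. [folklore] -/
theorem suppIn_litInd (l : Literal ℕ) : ∀ t : Bool, SuppIn {l.1} (litInd l t)
  | true => suppIn_ind _ _
  | false => suppIn_ind _ _

/-! ### Local assignments of a clause: orthogonal idempotents and the `elem` homomorphism -/

variable {k : ℕ}

/-- The indicator of the local truth-value pattern `τ` of the literals `L 0, …, L (k-1)`: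
`∏_j litInd (L j) (τ j)`. [Atserias–Ochremiak 2019, §6.4 (the functional `E` on local
assignments)] [folklore] -/
def eLoc (L : Fin k → Literal ℕ) (τ : Fin k → Bool) : ParityAlg :=
  ∏ j, litInd (L j) (τ j)

/-- The `eLoc L τ` are orthogonal idempotents. [folklore] -/
theorem eLoc_mul_eLoc (L : Fin k → Literal ℕ) (τ τ' : Fin k → Bool) :
    eLoc L τ * eLoc L τ' = if τ = τ' then eLoc L τ else 0 := by
  unfold eLoc
  rw [← Finset.prod_mul_distrib]
  split_ifs with h
  · subst h
    exact Finset.prod_congr rfl fun j _ => by rw [litInd_mul_litInd, if_pos rfl]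
  · obtain ⟨j, hj⟩ : ∃ j, τ j ≠ τ' j := by
      by_contra hcon
      push Not at hcon
      exact h (funext hcon)
    exact Finset.prod_eq_zero (Finset.mem_univ j) (by rw [litInd_mul_litInd, if_neg hj])

/-- … summing to `1`. [folklore] -/
theorem sum_eLoc (L : Fin k → Literal ℕ) : ∑ τ, eLoc L τ = 1 := by
  unfold eLoc
  rw [← Fintype.prod_sum (fun j t => litInd (L j) t)]
  exact Finset.prod_eq_one fun j _ => by rw [Fintype.sum_bool]; exact litInd_add (L j)

/-- Multiplying by the indicator of one literal value selects the patterns with that value.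
[folklore] -/
theorem litInd_mul_eLoc (L : Fin k → Literal ℕ) (j : Fin k) (t : Bool) (τ : Fin k → Bool) :
    litInd (L j) t * eLoc L τ = if τ j = t then eLoc L τ else 0 := by
  unfold eLoc
  rw [← Finset.mul_prod_erase Finset.univ (fun j => litInd (L j) (τ j)) (Finset.mem_univ j),
    ← mul_assoc, litInd_mul_litInd]
  split_ifs with h1 h2 h2
  · rw [h1]
  · exact absurd h1.symm h2
  · exact absurd h2.symm h1
  · rw [zero_mul]

/-- The element of the parity algebra represented by a real function of the local pattern:
`elem L f = Σ_τ f(τ) eLoc L τ`. [Atserias–Ochremiak 2019, §6.4] [folklore] -/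
def elem (L : Fin k → Literal ℕ) (f : (Fin k → Bool) → ℝ) : ParityAlg :=
  ∑ τ, f τ • eLoc L τ

/-- `elem` is multiplicative. [folklore] -/
theorem elem_mul_elem (L : Fin k → Literal ℕ) (f g : (Fin k → Bool) → ℝ) :
    elem L f * elem L g = elem L (f * g) := by
  unfold elem
  rw [Finset.sum_mul_sum]
  refine Finset.sum_congr rfl fun τ _ => ?_
  rw [Finset.sum_eq_single τ]
  · rw [smul_mul_smul_comm, eLoc_mul_eLoc, if_pos rfl, Pi.mul_apply]
  · intro τ' _ hne
    rw [smul_mul_smul_comm, eLoc_mul_eLoc, if_neg (Ne.symm hne), smul_zero]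
  · intro h
    exact absurd (Finset.mem_univ τ) h

/-- `elem` is additive. [folklore] -/
theorem elem_add (L : Fin k → Literal ℕ) (f g : (Fin k → Bool) → ℝ) :
    elem L (f + g) = elem L f + elem L g := by
  unfold elem
  rw [← Finset.sum_add_distrib]
  exact Finset.sum_congr rfl fun τ _ => by rw [Pi.add_apply, add_smul]

/-- `elem` is subtractive. [folklore] -/
theorem elem_sub (L : Fin k → Literal ℕ) (f g : (Fin k → Bool) → ℝ) :
    elem L (f - g) = elem L f - elem L g := by
  unfold elem
  rw [← Finset.sum_sub_distrib]
  exact Finset.sum_congr rfl fun τ _ => by rw [Pi.sub_apply, sub_smul]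

/-- `elem` commutes with finite sums. [folklore] -/
theorem elem_finset_sum {ι : Type*} (L : Fin k → Literal ℕ) (s : Finset ι)
    (f : ι → (Fin k → Bool) → ℝ) : elem L (∑ i ∈ s, f i) = ∑ i ∈ s, elem L (f i) := by
  unfold elem
  simp_rw [Finset.sum_apply, Finset.sum_smul]
  exact Finset.sum_comm

/-- `elem` of a constant function is that constant. [folklore] -/
theorem elem_const (L : Fin k → Literal ℕ) (c : ℝ) : elem L (fun _ => c) = c • (1 : ParityAlg) := by
  unfold elem
  rw [← Finset.smul_sum, sum_eLoc]

/-- `elem` of a `0/1` constant. [folklore] -/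
theorem elem_const_ite (L : Fin k → Literal ℕ) (p : Prop) [Decidable p] :
    elem L (fun _ => if p then 1 else 0) = if p then 1 else 0 := by
  rw [elem_const]
  split_ifs <;> simp

/-- `elem 1 = 1`. [folklore] -/
theorem elem_one (L : Fin k → Literal ℕ) : elem L (fun _ => 1) = 1 := by
  rw [elem_const, one_smul]

/-- `elem 0 = 0`. [folklore] -/
theorem elem_zero (L : Fin k → Literal ℕ) : elem L (fun _ => 0) = 0 := by
  rw [elem_const, zero_smul]

/-- `elem` of the indicator of one pattern is that pattern's idempotent. [folklore] -/
theorem elem_single (L : Fin k → Literal ℕ) (τ₀ : Fin k → Bool) :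
    elem L (fun τ => if τ = τ₀ then 1 else 0) = eLoc L τ₀ := by
  unfold elem
  simp_rw [ite_smul, one_smul, zero_smul]
  rw [Finset.sum_ite_eq']
  simp

/-- A single literal indicator as an `elem`. [folklore] -/
theorem litInd_eq_elem (L : Fin k → Literal ℕ) (j : Fin k) (t : Bool) :
    litInd (L j) t = elem L (fun τ => if τ j = t then 1 else 0) := by
  unfold elem
  simp_rw [ite_smul, one_smul, zero_smul]
  rw [← mul_one (litInd (L j) t), ← sum_eLoc L, Finset.mul_sum]
  exact Finset.sum_congr rfl fun τ _ => litInd_mul_eLoc L j t τ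

/-- The variables of the literals `L j`. [folklore] -/
def locScope (L : Fin k → Literal ℕ) : Finset ℕ :=
  Finset.univ.biUnion fun j => {(L j).1}

/-- The local scope has at most `k` variables. [folklore] -/
theorem card_locScope_le (L : Fin k → Literal ℕ) : (locScope L).card ≤ k := by
  unfold locScope
  refine Finset.card_biUnion_le.trans ?_
  simp

/-- `eLoc L τ` only involves the variables of `L`. [folklore] -/
theorem suppIn_eLoc (L : Fin k → Literal ℕ) (τ : Fin k → Bool) : SuppIn (locScope L) (eLoc L τ) :=
  SuppIn.prod fun j _ => suppIn_litInd (L j) (τ j)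

/-- `elem L f` only involves the variables of `L`. [folklore] -/
theorem suppIn_elem (L : Fin k → Literal ℕ) (f : (Fin k → Bool) → ℝ) : SuppIn (locScope L) (elem L f) :=
  SuppIn.sum fun τ _ => (suppIn_eLoc L τ).smul _

/-- The arithmetised unsatisfaction polynomial of the clause `[L 0, …, L (k-1)]` is the idempotent
of the all-false pattern. [Schoenebeck 2008, §5] [folklore] -/
theorem phi_unsatPoly_ofFn (L : Fin k → Literal ℕ) :
    phi (unsatPoly (List.ofFn L)) = eLoc L (fun _ => false) := by
  rw [unsatPoly, List.map_ofFn, List.prod_ofFn, map_prod]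
  exact Finset.prod_congr rfl fun j _ => phi_litFalsePoly_eq (L j)

/-! ### The pushforward of the Grigoriev–Schoenebeck functional along a local interpretation -/

/-- `0` is supported anywhere. [folklore] -/
theorem suppIn_zero (B : Finset ℕ) : SuppIn B (0 : ParityAlg) := by
  intro T hT
  simp at hT

/-- The images of the colour indeterminates `X (3 w + a)` under a local interpretation `P`
(indeterminates off the board go to `0`). [Atserias–Ochremiak 2019, §6.4 and §8.1] [folklore] -/
def substQ (N : ℕ) (P : Fin N → Fin 3 → ParityAlg) (i : ℕ) : ParityAlg :=
  if h : i / 3 < N then P ⟨i / 3, h⟩ ⟨i % 3, Nat.mod_lt _ (by norm_num)⟩ else 0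

variable {N : ℕ} {P : Fin N → Fin 3 → ParityAlg}

/-- `substQ N P (3 w + a) = P w a`. [folklore] -/
theorem substQ_apply (P : Fin N → Fin 3 → ParityAlg) (v : Fin N) (a : Fin 3) :
    substQ N P (3 * v.val + a.val) = P v a := by
  have h1 : (3 * v.val + a.val) / 3 = v.val := by
    rw [Nat.mul_add_div (by norm_num), Nat.div_eq_of_lt a.isLt, add_zero]
  have h2 : (3 * v.val + a.val) % 3 = a.val := by
    rw [Nat.mul_add_mod, Nat.mod_eq_of_lt a.isLt]
  unfold substQ
  have hlt : (3 * v.val + a.val) / 3 < N := by rw [h1]; exact v.isLt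
  rw [dif_pos hlt]
  congr 1
  · exact Fin.ext h1
  · exact Fin.ext h2

/-- The images are idempotent if the `P w a` are. [folklore] -/
theorem substQ_mul_self (hidem : ∀ w a, P w a * P w a = P w a) (i : ℕ) :
    substQ N P i * substQ N P i = substQ N P i := by
  unfold substQ
  split_ifs with h
  · exact hidem _ _
  · exact mul_zero _

/-- The images have supports of size `≤ s` if the `P w a` do. [folklore] -/
theorem substQ_supp {s : ℕ} (hsupp : ∀ w a, ∃ B : Finset ℕ, B.card ≤ s ∧ SuppIn B (P w a))
    (i : ℕ) : ∃ B : Finset ℕ, B.card ≤ s ∧ SuppIn B (substQ N P i) := by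
  unfold substQ
  split_ifs with h
  · exact hsupp _ _
  · exact ⟨∅, by simp, suppIn_zero _⟩

/-- **Degree control for a local interpretation.** If every image `Q i` involves at most `s`
variables then every monomial `y_T` of `aeval Q p` has `|T| ≤ s · deg p`.
[Atserias–Ochremiak 2019, §6.4 (degree of the composed functional); Thapper–Živný 2018, Def. 13]
[folklore] -/
theorem card_support_aeval_le {Q : ℕ → ParityAlg} {s : ℕ}
    (hQ : ∀ i, ∃ B : Finset ℕ, B.card ≤ s ∧ SuppIn B (Q i)) (p : MvPolynomial ℕ ℝ) {T : ParityVec}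
    (hT : T ∈ (MvPolynomial.aeval Q p).coeff.support) : T.support.card ≤ s * p.totalDegree := by
  classical
  choose B hB using hQ
  rw [p.as_sum, map_sum, AddMonoidAlgebra.coeff_sum] at hT
  obtain ⟨α, hα, hTα⟩ := Finset.mem_biUnion.1 (Finsupp.support_finsetSum hT)
  have hmon : SuppIn (α.support.biUnion B) (MvPolynomial.aeval Q (monomial α (coeff α p))) := by
    rw [MvPolynomial.aeval_monomial, Finsupp.prod]
    have h1 : SuppIn ∅ (algebraMap ℝ ParityAlg (coeff α p)) := by
      rw [AddMonoidAlgebra.coe_algebraMap, Function.comp_apply, Algebra.algebraMap_self_apply]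
      exact suppIn_single (by simp) _
    have h2 : SuppIn (α.support.biUnion B) (∏ v ∈ α.support, Q v ^ α v) :=
      SuppIn.prod fun v _ => (hB v).2.pow _
    simpa using h1.mul h2
  have hsub : T.support ⊆ α.support.biUnion B := hmon T hTα
  have hdeg : α.support.card ≤ p.totalDegree := by
    refine le_trans ?_ (MvPolynomial.le_totalDegree hα)
    rw [Finsupp.sum, Finset.card_eq_sum_ones]
    exact Finset.sum_le_sum fun v hv => Nat.one_le_iff_ne_zero.2 (Finsupp.mem_support_iff.1 hv)
  calc T.support.card ≤ (α.support.biUnion B).card := Finset.card_le_card hsub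
    _ ≤ ∑ v ∈ α.support, (B v).card := Finset.card_biUnion_le
    _ ≤ ∑ v ∈ α.support, s := Finset.sum_le_sum fun v _ => (hB v).1
    _ = s * α.support.card := by rw [Finset.sum_const, smul_eq_mul, mul_comm]
    _ ≤ s * p.totalDegree := Nat.mul_le_mul_left s hdeg

/-- **The pushforward theorem** (SOS solutions transfer along local interpretations; the
Sum-of-Squares half of "reductions preserve Lasserre levels" for one interpretation). Let `φ`
have `(r, c)`-vector-expanding scope vectors, `c > 0`, `r ≥ 2`, `D ≤ c r / 2`, so that the
Grigoriev–Schoenebeck moment functional `L` of degree `D` exists. Let `P w a ∈ ℝ[ParityVec]`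
(`w` a vertex of a graph `G` on `Fin N`, `a` a colour) be supported on `≤ s` variables each, with
`P w a` idempotent, `P w a · P w b = 0` (`a ≠ b`), `P u a · P w a = 0` on edges, and
`Σ_a P w a = 1` or `1 - Σ_a P w a = phi (unsatPoly C)` for a clause `C ∈ φ` of length in
`(0, s]`. Then `L ∘ aeval (substQ N P)` is a degree-`d` pseudoexpectation for the 3-colouring
system of `G` whenever `s d + s ≤ D`. [Thapper–Živný 2018, Def. 13 with §5–6 (reductions);
Atserias–Ochremiak 2019, Thm. 7 and §6.4] [folklore] -/
theorem threeColPseudoexpectation_of_local (φ : CNF ℕ) {r c : ℝ} {D d s : ℕ}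
    (hexp : VecExpands (cnfVecs φ) r c) (hc : 0 < c) (hr : 2 ≤ r) (hD : (D : ℝ) ≤ c * r / 2)
    {G : SimpleGraph (Fin N)} (P : Fin N → Fin 3 → ParityAlg)
    (hsupp : ∀ w a, ∃ B : Finset ℕ, B.card ≤ s ∧ SuppIn B (P w a))
    (hidem : ∀ w a, P w a * P w a = P w a)
    (horth : ∀ w a b, a ≠ b → P w a * P w b = 0)
    (hedge : ∀ u w, G.Adj u w → ∀ a, P u a * P w a = 0)
    (htotal : ∀ w, (∑ a, P w a = 1) ∨
      ∃ C ∈ φ, 0 < C.length ∧ C.length ≤ s ∧ 1 - ∑ a, P w a = phi (unsatPoly C))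
    (hd : s * d + s ≤ D) :
    ThreeColPseudoexpectation N G d
      (momentFunctional (pseudoMoment (cnfVecs φ) (cnfSigns φ) r D) ∘ₗ
        (MvPolynomial.aeval (substQ N P)).toLinearMap) := by
  classical
  have hb : ∀ i, cnfSigns φ i * cnfSigns φ i = 1 := fun i => clauseSign_mul_self _
  have hr0 : (0 : ℝ) ≤ r := by linarith
  have hQsupp : ∀ i, ∃ B : Finset ℕ, B.card ≤ s ∧ SuppIn B (substQ N P i) := substQ_supp hsupp
  set Ψ := MvPolynomial.aeval (R := ℝ) (substQ N P) with hΨ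
  refine ⟨⟨?_, ?_⟩, ?_, ?_, ?_, ?_⟩
  · -- normalisation
    show momentFunctional _ (Ψ 1) = 1
    rw [map_one, AddMonoidAlgebra.one_def, momentFunctional_single, one_mul,
      pseudoMoment_zero hexp hc hD hr0]
  · -- positivity
    intro p hp
    show 0 ≤ momentFunctional _ (Ψ (p * p))
    rw [map_mul, momentFunctional_mul]
    refine pseudoMoment_quadratic_nonneg hexp hc hD hr0 hb _ (fun T => (Ψ p).coeff T) ?_
    intro T hT
    have h1 := card_support_aeval_le hQsupp p hT
    have h2 : s * (2 * p.totalDegree) ≤ s * d := Nat.mul_le_mul_left s hp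
    calc 2 * T.support.card ≤ 2 * (s * p.totalDegree) := Nat.mul_le_mul_left 2 h1
      _ = s * (2 * p.totalDegree) := by ring
      _ ≤ s * d := h2
      _ ≤ D := le_trans (Nat.le_add_right _ _) hd
  · -- Booleanity
    intro i q _
    show momentFunctional _ (Ψ (boolAxiom i * q)) = 0
    rw [map_mul, boolAxiom, map_sub, map_pow, MvPolynomial.aeval_X, sq, substQ_mul_self hidem,
      sub_self, zero_mul, map_zero]
  · -- every vertex gets a colour
    intro v q hq
    show momentFunctional _ (Ψ ((1 - ∑ a : Fin 3, X (3 * v.val + a.val)) * q)) = 0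
    have hΨv : Ψ (1 - ∑ a : Fin 3, X (3 * v.val + a.val)) = 1 - ∑ a, P v a := by
      rw [map_sub, map_one, map_sum]
      congr 1
      exact Finset.sum_congr rfl fun a _ => by rw [MvPolynomial.aeval_X, substQ_apply]
    rw [map_mul, hΨv]
    rcases htotal v with h | ⟨C, hC, hlen, hlen', hPC⟩
    · rw [h, sub_self, zero_mul, map_zero]
    · rw [hPC]
      obtain ⟨n, hn, hCn⟩ := List.mem_iff_getElem.1 hC
      let i : Fin φ.length := ⟨n, hn⟩
      have hφi : φ[i] = C := hCn
      have hgi : cnfVecs φ i = clauseVec C := by rw [cnfVecs, hφi]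
      have hbi : cnfSigns φ i = clauseSign C := by rw [cnfSigns, hφi]
      refine momentFunctional_phi_unsatPoly_mul hexp hc hD hr hb C hlen i hgi hbi (Ψ q) ?_
      intro U hU
      have h1 := card_support_aeval_le hQsupp q hU
      have hq' : q.totalDegree ≤ d := le_trans (Nat.le_add_left _ _) hq
      calc U.support.card + C.length ≤ s * d + s :=
            add_le_add (h1.trans (Nat.mul_le_mul_left s hq')) hlen'
        _ ≤ D := hd
  · -- one colour per vertex
    intro v a b hab q _
    show momentFunctional _ (Ψ (X (3 * v.val + a.val) * X (3 * v.val + b.val) * q)) = 0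
    rw [map_mul Ψ, map_mul Ψ, MvPolynomial.aeval_X, MvPolynomial.aeval_X, substQ_apply,
      substQ_apply, horth v a b hab, zero_mul, map_zero]
  · -- edges
    intro u v huv a q _
    show momentFunctional _ (Ψ (X (3 * u.val + a.val) * X (3 * v.val + a.val) * q)) = 0
    rw [map_mul Ψ, map_mul Ψ, MvPolynomial.aeval_X, MvPolynomial.aeval_X, substQ_apply,
      substQ_apply, hedge u v huv a, zero_mul, map_zero]


/-! ### The textbook 3-SAT → 3-COLOURING gadgets and their canonical local colourings -/

/-- Canonical colouring `(p, q, o)` of a 2-input OR gadget given the truth values of its two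
inputs (colours `0 = T`, `1 = F`, `2 = B`; an input vertex has colour `T` iff it is true): the
output `o` gets colour `T` iff some input is true. [Garey–Johnson–Stockmeyer 1976, Thm. 2.2]
[folklore] -/
def orCol (t₁ t₂ : Bool) : Fin 3 × Fin 3 × Fin 3 :=
  if t₁ then (1, 2, 0) else if t₂ then (2, 1, 0) else (0, 2, 1)

/-- Canonical colour of the gadget vertex `j` of a clause under the literal values `t0 t1 t2`:
`j = 0,1,2` are `p₁,q₁,o₁` of the OR of literals `0,1`, and `j = 3,4,5` are `p₂,q₂,o₂` of the OR
of `o₁` and literal `2`. [Garey–Johnson–Stockmeyer 1976, Thm. 2.2] [folklore] -/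
def gadCol (j : Fin 6) (t0 t1 t2 : Bool) : Fin 3 :=
  ![(orCol t0 t1).1, (orCol t0 t1).2.1, (orCol t0 t1).2.2,
    (orCol (t0 || t1) t2).1, (orCol (t0 || t1) t2).2.1, (orCol (t0 || t1) t2).2.2] j

/-- The internal edges `p₁q₁, p₁o₁, q₁o₁, o₁p₂, p₂q₂, p₂o₂, q₂o₂` of a clause gadget (one
orientation). [folklore] -/
def gadE (j j' : Fin 6) : Bool :=
  decide ((j.val, j'.val) ∈ [(0, 1), (0, 2), (1, 2), (2, 3), (3, 4), (3, 5), (4, 5)])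

/-- The input edges: `p₁`–literal `0`, `q₁`–literal `1`, `q₂`–literal `2`. [folklore] -/
def inp (j : Fin 6) (j' : Fin 3) : Bool :=
  decide ((j.val, j'.val) ∈ [(0, 0), (1, 1), (4, 2)])

/-- The canonical colouring is proper on internal edges whenever some literal is true.
[folklore] -/
theorem gadCol_ne_of_gadE : ∀ j j' : Fin 6, gadE j j' = true → ∀ t0 t1 t2 : Bool,
    (t0 || t1 || t2) = true → gadCol j t0 t1 t2 ≠ gadCol j' t0 t1 t2 := by
  decide

/-- … and on input edges (the vertex of literal `j'` has colour `T = 0` iff it is true, else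
`F = 1`). [folklore] -/
theorem gadCol_ne_of_inp : ∀ (j : Fin 6) (j' : Fin 3), inp j j' = true → ∀ t0 t1 t2 : Bool,
    (t0 || t1 || t2) = true →
      gadCol j t0 t1 t2 ≠ (if (![t0, t1, t2] : Fin 3 → Bool) j' = true then 0 else 1) := by
  decide

/-- … and the output `o₂` gets colour `T = 0` (so the edges `o₂F`, `o₂B` are proper).
[folklore] -/
theorem gadCol_five : ∀ t0 t1 t2 : Bool, (t0 || t1 || t2) = true → gadCol 5 t0 t1 t2 = 0 := by
  decide

/-- No internal loops. [folklore] -/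
theorem gadE_irrefl : ∀ j : Fin 6, gadE j j = false := by
  decide

/-- Some literal of the clause is true under the local pattern `τ`. [folklore] -/
def someTrue (τ : Fin 3 → Bool) : Bool :=
  τ 0 || τ 1 || τ 2

/-- `someTrue τ = false` iff `τ` is the all-false pattern. [folklore] -/
theorem someTrue_eq_false_iff (τ : Fin 3 → Bool) : someTrue τ = false ↔ τ = fun _ => false := by
  constructor
  · intro h
    have h' : τ 0 = false ∧ τ 1 = false ∧ τ 2 = false := by
      revert h
      unfold someTrue
      cases τ 0 <;> cases τ 1 <;> cases τ 2 <;> simp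
    funext j
    fin_cases j
    · simpa using h'.1
    · simpa using h'.2.1
    · simpa using h'.2.2
  · rintro rfl
    rfl

/-- The local function of gadget vertex `j`, colour `a`: the indicator that some literal is true
and the canonical colour of `j` is `a` (the all-false pattern carries no mass). [folklore] -/
def fgad (j : Fin 6) (a : Fin 3) (τ : Fin 3 → Bool) : ℝ :=
  if someTrue τ = true ∧ gadCol j (τ 0) (τ 1) (τ 2) = a then 1 else 0

/-- The local function of the vertex of literal `j'`, colour `a`. [folklore] -/
def finp (j' : Fin 3) (a : Fin 3) (τ : Fin 3 → Bool) : ℝ :=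
  if (if τ j' = true then (0 : Fin 3) else 1) = a then 1 else 0

/-- `fgad` is `0/1`-valued. [folklore] -/
theorem fgad_mul_self (j : Fin 6) (a : Fin 3) (τ : Fin 3 → Bool) :
    fgad j a τ * fgad j a τ = fgad j a τ := by
  unfold fgad
  split_ifs <;> norm_num

/-- Different colours of one gadget vertex are exclusive. [folklore] -/
theorem fgad_mul_fgad_of_ne (j : Fin 6) {a b : Fin 3} (h : a ≠ b) (τ : Fin 3 → Bool) :
    fgad j a τ * fgad j b τ = 0 := by
  unfold fgad
  split_ifs with h1 h2 <;> try simp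
  exact absurd (h1.2.symm.trans h2.2) h

/-- Internal edges are properly coloured. [folklore] -/
theorem fgad_mul_fgad_of_gadE {j j' : Fin 6} (h : gadE j j' = true) (a : Fin 3)
    (τ : Fin 3 → Bool) : fgad j a τ * fgad j' a τ = 0 := by
  unfold fgad
  split_ifs with h1 h2 <;> try simp
  exact absurd (h1.2.trans h2.2.symm) (gadCol_ne_of_gadE j j' h _ _ _ h1.1)

/-- Input edges are properly coloured. [folklore] -/
theorem fgad_mul_finp_of_inp {j : Fin 6} {j' : Fin 3} (h : inp j j' = true) (a : Fin 3)
    (τ : Fin 3 → Bool) : fgad j a τ * finp j' a τ = 0 := by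
  unfold fgad finp
  by_cases h1 : someTrue τ = true ∧ gadCol j (τ 0) (τ 1) (τ 2) = a
  · rw [if_pos h1, one_mul, if_neg]
    intro h2
    have h3 := gadCol_ne_of_inp j j' h (τ 0) (τ 1) (τ 2) h1.1
    have hv : (![τ 0, τ 1, τ 2] : Fin 3 → Bool) j' = τ j' := by
      fin_cases j' <;> rfl
    rw [hv] at h3
    exact h3 (h1.2.trans h2.symm)
  · rw [if_neg h1, zero_mul]

/-- The output `o₂` is never coloured `F` or `B`. [folklore] -/
theorem fgad_five_mul_ite {s : Fin 3} (hs : s ≠ 0) (a : Fin 3) (τ : Fin 3 → Bool) :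
    fgad 5 a τ * (if s = a then 1 else 0) = 0 := by
  unfold fgad
  split_ifs with h1 h2 <;> try simp
  have h3 := gadCol_five (τ 0) (τ 1) (τ 2) h1.1
  exact absurd (h2.trans (h1.2.symm.trans h3)) hs

/-- A gadget vertex gets exactly one colour unless all literals are false. [folklore] -/
theorem sum_fgad (j : Fin 6) (τ : Fin 3 → Bool) :
    ∑ a, fgad j a τ = if someTrue τ = true then 1 else 0 := by
  unfold fgad
  by_cases h : someTrue τ = true
  · simp only [h, true_and, if_true]
    rw [Finset.sum_ite_eq]
    simp
  · simp [h]

/-! ### The gadget graph of a 3-CNF and its local interpretation -/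

variable {nv m pad : ℕ}

/-- The vertex type of the gadget graph: the special triangle `T, F, B` (`Fin 3`) | one vertex per
literal `(v, b)` over `nv` variables | six gadget vertices per clause | `pad` isolated vertices.
[Garey–Johnson–Stockmeyer 1976, Thm. 2.2] [folklore] -/
abbrev Vtx (nv m pad : ℕ) : Type :=
  (Fin 3 ⊕ (Fin nv × Bool)) ⊕ ((Fin m × Fin 6) ⊕ Fin pad)

/-- The vertex type has `3 + 2 nv + 6 m + pad` elements. [folklore] -/
theorem card_vtx (nv m pad : ℕ) : Fintype.card (Vtx nv m pad) = 3 + 2 * nv + (6 * m + pad) := by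
  simp only [Vtx, Fintype.card_sum, Fintype.card_prod, Fintype.card_fin, Fintype.card_bool]
  ring

/-- The colour indicators of the vertex of the literal `l`: colour `T` iff `l` is true, `F` iff
false, never `B`. [Atserias–Ochremiak 2019, §8.2] [folklore] -/
def litP (l : Literal ℕ) (a : Fin 3) : ParityAlg :=
  if a = 0 then litInd l true else if a = 1 then litInd l false else 0

/-- The local interpretation of the colour indicators of the gadget graph of the clauses
`[L i 0, L i 1, L i 2]`: specials and padding are constants, literal vertices are literal
indicators, gadget vertices are `elem` of their local functions. [Atserias–Ochremiak 2019, §6.4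
and §8.2] [folklore] -/
def gadP (L : Fin m → Fin 3 → Literal ℕ) : Vtx nv m pad → Fin 3 → ParityAlg
  | Sum.inl (Sum.inl s), a => if s = a then 1 else 0
  | Sum.inl (Sum.inr vb), a => litP (vb.1.val, vb.2) a
  | Sum.inr (Sum.inl ij), a => elem (L ij.1) (fgad ij.2 a)
  | Sum.inr (Sum.inr _), a => if (0 : Fin 3) = a then 1 else 0

/-- One orientation of the edges of the gadget graph: the special triangle; `(v,true)(v,false)`
and both to `B`; gadget-internal edges; input edges to the literal vertices of the clause;
`o₂F`, `o₂B`. [Garey–Johnson–Stockmeyer 1976, Thm. 2.2] [folklore] -/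
def gadR (L : Fin m → Fin 3 → Literal ℕ) : Vtx nv m pad → Vtx nv m pad → Prop
  | Sum.inl (Sum.inl s), Sum.inl (Sum.inl s') => s ≠ s'
  | Sum.inl (Sum.inr vb), Sum.inl (Sum.inr vb') => vb.1 = vb'.1 ∧ vb.2 ≠ vb'.2
  | Sum.inl (Sum.inr _), Sum.inl (Sum.inl s) => s = 2
  | Sum.inr (Sum.inl ij), Sum.inr (Sum.inl ij') => ij.1 = ij'.1 ∧ gadE ij.2 ij'.2 = true
  | Sum.inr (Sum.inl ij), Sum.inl (Sum.inr vb) =>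
      ∃ j' : Fin 3, inp ij.2 j' = true ∧ L ij.1 j' = (vb.1.val, vb.2)
  | Sum.inr (Sum.inl ij), Sum.inl (Sum.inl s) => ij.2 = 5 ∧ s ≠ 0
  | _, _ => False

/-- The gadget graph of the 3-CNF with clauses `[L i 0, L i 1, L i 2]`, `i < m`, over `nv`
variables, padded with `pad` isolated vertices. [Garey–Johnson–Stockmeyer 1976, Thm. 2.2]
[folklore] -/
def gadGraph (L : Fin m → Fin 3 → Literal ℕ) : SimpleGraph (Vtx nv m pad) :=
  SimpleGraph.fromRel (gadR L)

/-- `gadR` has no loops. [folklore] -/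
theorem gadR_irrefl (L : Fin m → Fin 3 → Literal ℕ) : ∀ x : Vtx nv m pad, ¬ gadR L x x := by
  rintro (⟨s | ⟨v, b⟩⟩ | ⟨⟨i, j⟩ | q⟩) h <;> simp [gadR, gadE_irrefl] at h

/-- `litP l a` is idempotent. [folklore] -/
theorem litP_mul_self (l : Literal ℕ) (a : Fin 3) : litP l a * litP l a = litP l a := by
  unfold litP
  split_ifs
  · exact (litInd_mul_litInd l true true).trans (if_pos rfl)
  · exact (litInd_mul_litInd l false false).trans (if_pos rfl)
  · exact mul_zero _

/-- Distinct colours of a literal vertex are exclusive. [folklore] -/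
theorem litP_mul_litP_of_ne (l : Literal ℕ) {a b : Fin 3} (h : a ≠ b) : litP l a * litP l b = 0 := by
  unfold litP
  split_ifs <;> simp_all [litInd_mul_litInd]

/-- The two vertices of a variable never share a colour. [folklore] -/
theorem litP_mul_litP_of_snd_ne (v : ℕ) {b b' : Bool} (h : b ≠ b') (a : Fin 3) :
    litP (v, b) a * litP (v, b') a = 0 := by
  unfold litP
  split_ifs
  · exact ind_mul_of_ne v h
  · exact ind_mul_of_ne v (by cases b <;> cases b' <;> simp_all)
  · exact mul_zero _

/-- A literal vertex is never coloured `B`. [folklore] -/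
theorem litP_two (l : Literal ℕ) : litP l 2 = 0 := by
  simp [litP]

/-- The colours of a literal vertex sum to one. [folklore] -/
theorem sum_litP (l : Literal ℕ) : ∑ a, litP l a = 1 := by
  rw [Fin.sum_univ_three]
  simp only [litP, if_true, Fin.one_eq_zero_iff, OfNat.ofNat_ne_one, if_false,
    show (2 : Fin 3) ≠ 0 by decide, show (2 : Fin 3) ≠ 1 by decide, add_zero]
  simpa using litInd_add l

/-- `litP l a` only involves the variable of `l`. [folklore] -/
theorem suppIn_litP (l : Literal ℕ) (a : Fin 3) : SuppIn {l.1} (litP l a) := by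
  unfold litP
  split_ifs
  · exact suppIn_litInd l true
  · exact suppIn_litInd l false
  · exact suppIn_zero _

/-- The literal vertex of literal `j'` of a clause as an `elem` of that clause. [folklore] -/
theorem litP_eq_elem (L : Fin 3 → Literal ℕ) (j' : Fin 3) (a : Fin 3) :
    litP (L j') a = elem L (finp j' a) := by
  unfold litP finp
  split_ifs with h0 h1
  · subst h0
    rw [litInd_eq_elem L j' true]
    congr 1
    funext τ
    cases τ j' <;> simp
  · subst h1
    rw [litInd_eq_elem L j' false]
    congr 1
    funext τ
    cases τ j' <;> simp
  · rw [← elem_zero L]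
    congr 1
    funext τ
    cases τ j' <;> simp [Ne.symm h0, Ne.symm h1]

/-- **Edges are properly interpreted**: `P x a · P y a = 0` along (one orientation of) every
edge. [Atserias–Ochremiak 2019, §8.2 (correctness of the interpretation)] [folklore] -/
theorem gadP_mul_of_gadR (L : Fin m → Fin 3 → Literal ℕ) :
    ∀ x y : Vtx nv m pad, gadR L x y → ∀ a, gadP L x a * gadP L y a = 0 := by
  rintro (⟨s | ⟨v, b⟩⟩ | ⟨⟨i, j⟩ | q⟩) (⟨s' | ⟨v', b'⟩⟩ | ⟨⟨i', j'⟩ | q'⟩) h a <;>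
    simp only [gadR] at h
  · -- special–special
    simp only [gadP]
    split_ifs <;> simp_all
  · -- literal–special `B`
    subst h
    simp only [gadP]
    by_cases ha : (2 : Fin 3) = a
    · subst ha
      rw [litP_two, zero_mul]
    · rw [if_neg ha, mul_zero]
  · -- the two vertices of a variable
    obtain ⟨rfl, hb⟩ := h
    exact litP_mul_litP_of_snd_ne _ hb a
  · -- output–special
    obtain ⟨rfl, hs⟩ := h
    simp only [gadP]
    rw [← elem_const_ite (L i) (s' = a), elem_mul_elem, ← elem_zero (L i)]
    congr 1
    funext τ
    exact fgad_five_mul_ite hs a τ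
  · -- gadget–literal input edge
    obtain ⟨j', hinp, hL⟩ := h
    simp only [gadP]
    rw [← hL, litP_eq_elem (L i) j' a, elem_mul_elem, ← elem_zero (L i)]
    congr 1
    funext τ
    exact fgad_mul_finp_of_inp hinp a τ
  · -- gadget-internal
    obtain ⟨rfl, hE⟩ := h
    simp only [gadP]
    rw [elem_mul_elem, ← elem_zero (L i)]
    congr 1
    funext τ
    exact fgad_mul_fgad_of_gadE hE a τ

/-- Hence along every edge of the gadget graph. [folklore] -/
theorem gadP_edge (L : Fin m → Fin 3 → Literal ℕ) {x y : Vtx nv m pad} (h : (gadGraph L).Adj x y)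
    (a : Fin 3) : gadP L x a * gadP L y a = 0 := by
  rw [gadGraph, SimpleGraph.fromRel_adj] at h
  rcases h.2 with h' | h'
  · exact gadP_mul_of_gadR L x y h' a
  · rw [mul_comm]
    exact gadP_mul_of_gadR L y x h' a

/-- The interpretation is idempotent. [folklore] -/
theorem gadP_mul_self (L : Fin m → Fin 3 → Literal ℕ) :
    ∀ (x : Vtx nv m pad) (a : Fin 3), gadP L x a * gadP L x a = gadP L x a := by
  rintro (⟨s | ⟨v, b⟩⟩ | ⟨⟨i, j⟩ | q⟩) a <;> simp only [gadP]
  · split_ifs <;> simp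
  · exact litP_mul_self _ a
  · rw [elem_mul_elem]
    congr 1
    funext τ
    exact fgad_mul_self j a τ
  · split_ifs <;> simp

/-- Distinct colours are exclusive. [folklore] -/
theorem gadP_orth (L : Fin m → Fin 3 → Literal ℕ) :
    ∀ (x : Vtx nv m pad) {a b : Fin 3}, a ≠ b → gadP L x a * gadP L x b = 0 := by
  rintro (⟨s | ⟨v, b⟩⟩ | ⟨⟨i, j⟩ | q⟩) a a' h <;> simp only [gadP]
  · split_ifs <;> simp_all
  · exact litP_mul_litP_of_ne _ h
  · rw [elem_mul_elem, ← elem_zero (L i)]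
    congr 1
    funext τ
    exact fgad_mul_fgad_of_ne j h τ
  · split_ifs <;> simp_all

/-- Supports: every `P x a` involves at most `3` variables. [folklore] -/
theorem gadP_supp (L : Fin m → Fin 3 → Literal ℕ) :
    ∀ (x : Vtx nv m pad) (a : Fin 3), ∃ B : Finset ℕ, B.card ≤ 3 ∧ SuppIn B (gadP L x a) := by
  rintro (⟨s | ⟨v, b⟩⟩ | ⟨⟨i, j⟩ | q⟩) a <;> simp only [gadP]
  · refine ⟨∅, by simp, ?_⟩
    split_ifs
    · exact suppIn_one _
    · exact suppIn_zero _
  · exact ⟨{v.val}, by simp, suppIn_litP _ a⟩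
  · exact ⟨locScope (L i), card_locScope_le _, suppIn_elem _ _⟩
  · refine ⟨∅, by simp, ?_⟩
    split_ifs
    · exact suppIn_one _
    · exact suppIn_zero _

/-- Totality: the colours of every vertex sum to `1`, except for gadget vertices, where they sum
to `1 - phi (unsatPoly C)` for the clause `C` of the gadget. [Atserias–Ochremiak 2019, §6.4]
[folklore] -/
theorem gadP_total (L : Fin m → Fin 3 → Literal ℕ) :
    ∀ x : Vtx nv m pad, (∑ a, gadP L x a = 1) ∨
      ∃ C ∈ (List.ofFn fun i => List.ofFn (L i) : CNF ℕ), 0 < C.length ∧ C.length ≤ 3 ∧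
        1 - ∑ a, gadP L x a = phi (unsatPoly C) := by
  rintro (⟨s | ⟨v, b⟩⟩ | ⟨⟨i, j⟩ | q⟩) <;> simp only [gadP]
  · left
    rw [Finset.sum_ite_eq]
    simp
  · left
    exact sum_litP _
  · right
    refine ⟨List.ofFn (L i), List.mem_ofFn.2 ⟨i, rfl⟩, by simp, by simp, ?_⟩
    rw [phi_unsatPoly_ofFn, ← elem_finset_sum, ← elem_one (L i), ← elem_single (L i)]
    have h : (fun _ : Fin 3 → Bool => (1 : ℝ)) - (∑ a : Fin 3, fgad j a) =
        fun τ => if τ = (fun _ => false) then 1 else 0 := by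
      funext τ
      rw [Pi.sub_apply, Finset.sum_apply, sum_fgad]
      by_cases hτ : someTrue τ = true
      · have hne : τ ≠ fun _ => false := by
          intro h0
          rw [(someTrue_eq_false_iff τ).2 h0] at hτ
          exact Bool.false_ne_true hτ
        simp [hτ, hne]
      · have heq : τ = fun _ => false :=
          (someTrue_eq_false_iff τ).1 (by simpa using hτ)
        subst heq
        simp [someTrue]
    rw [← h, elem_sub]
  · left
    rw [Finset.sum_ite_eq]
    simp

/-- **The gadget graph fools SOS.** If the scope vectors of the 3-CNF `[L i 0, L i 1, L i 2]_i`
are `(r, c)`-vector expanding (`c > 0`, `r ≥ 2`) and `3 d + 3 ≤ D ≤ c r / 2`, then degree-`d`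
SOS fails to refute the 3-colourability of (any renaming to `Fin N` of) its gadget graph.
[Thapper–Živný 2018, Def. 13 (reductions preserve levels); Atserias–Ochremiak 2019, Thm. 7 with
§6.4 and §8.2] [folklore] -/
theorem sosFailsToRefuteThreeCol_gadGraph {N : ℕ} (L : Fin m → Fin 3 → Literal ℕ) {r c : ℝ}
    {D d : ℕ} (hexp : VecExpands (cnfVecs (List.ofFn fun i => List.ofFn (L i))) r c)
    (hc : 0 < c) (hr : 2 ≤ r) (hD : (D : ℝ) ≤ c * r / 2) (hd : 3 * d + 3 ≤ D)
    (e : Vtx nv m pad ≃ Fin N) :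
    SOSFailsToRefuteThreeCol d ((gadGraph L).comap e.symm) :=
  ⟨_, threeColPseudoexpectation_of_local (List.ofFn fun i => List.ofFn (L i)) hexp hc hr hD
    (fun w a => gadP L (e.symm w) a) (fun w a => gadP_supp L (e.symm w) a)
    (fun w a => gadP_mul_self L (e.symm w) a) (fun w _ _ hab => gadP_orth L (e.symm w) hab)
    (fun _ _ huw a => gadP_edge L ((SimpleGraph.comap_adj).1 huw) a)
    (fun w => gadP_total L (e.symm w)) hd⟩

/-! ### The gadget graph of an unsatisfiable formula is not 3-colourable -/

/-- The special vertex `s` (`0 = T`, `1 = F`, `2 = B`). [folklore] -/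
abbrev spV (s : Fin 3) : Vtx nv m pad := Sum.inl (Sum.inl s)

/-- The vertex of the literal `(v, b)`. [folklore] -/
abbrev lvV (v : Fin nv) (b : Bool) : Vtx nv m pad := Sum.inl (Sum.inr (v, b))

/-- The gadget vertex `j` of clause `i`. [folklore] -/
abbrev gdV (i : Fin m) (j : Fin 6) : Vtx nv m pad := Sum.inr (Sum.inl (i, j))

/-- Pigeonhole on three colours: in a 2-input OR gadget whose inputs are coloured `f`, the output
is coloured `f`. [Garey–Johnson–Stockmeyer 1976, proof of Thm. 2.2] [folklore] -/
theorem three_force : ∀ f p q o : Fin 3, p ≠ f → q ≠ f → p ≠ q → o ≠ p → o ≠ q → o = f := by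
  decide

/-- **Soundness of the gadgets.** If the gadget graph is properly 3-coloured then the formula is
satisfiable (read the truth value of `v` off the colour of the vertex `(v, true)` relative to the
colour of the special vertex `T`). [Garey–Johnson–Stockmeyer 1976, Thm. 2.2] [folklore] -/
theorem satisfiable_of_colorable (L : Fin m → Fin 3 → Literal ℕ) (hL : ∀ i j, (L i j).1 < nv)
    (h : (gadGraph L : SimpleGraph (Vtx nv m pad)).Colorable 3) :
    CNF.Satisfiable (List.ofFn fun i => List.ofFn (L i)) := by
  classical
  obtain ⟨κ⟩ := h
  have hadj : ∀ x y, gadR L x y → κ x ≠ κ y := by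
    intro x y hxy
    have hne : x ≠ y := fun h0 => gadR_irrefl L y (h0 ▸ hxy)
    exact κ.valid ((SimpleGraph.fromRel_adj _ _ _).2 ⟨hne, Or.inl hxy⟩)
  -- the special triangle
  have hTF : κ (spV 0) ≠ κ (spV 1) := hadj (spV 0) (spV 1) (show (0 : Fin 3) ≠ 1 by decide)
  have hTB : κ (spV 0) ≠ κ (spV 2) := hadj (spV 0) (spV 2) (show (0 : Fin 3) ≠ 2 by decide)
  have hFB : κ (spV 1) ≠ κ (spV 2) := hadj (spV 1) (spV 2) (show (1 : Fin 3) ≠ 2 by decide)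
  -- the assignment
  let σ : ℕ → Bool := fun v =>
    if hv : v < nv then decide (κ (lvV ⟨v, hv⟩ true) = κ (spV 0)) else false
  -- a false literal has its vertex coloured like `F`
  have hlit : ∀ (v : Fin nv) (b : Bool), Literal.eval σ (v.val, b) = false →
      κ (lvV v b) = κ (spV 1) := by
    intro v b hev
    have h1 : κ (lvV v true) ≠ κ (lvV v false) :=
      hadj (lvV v true) (lvV v false) ⟨rfl, show true ≠ false by decide⟩
    have h2 : κ (lvV v true) ≠ κ (spV 2) := hadj (lvV v true) (spV 2) rfl
    have h3 : κ (lvV v false) ≠ κ (spV 2) := hadj (lvV v false) (spV 2) rfl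
    have hσ : σ v.val = decide (κ (lvV v true) = κ (spV 0)) := by
      simp [σ, v.isLt]
    simp only [Literal.eval, hσ] at hev
    cases b
    · have hP : κ (lvV v true) = κ (spV 0) := by simpa using hev
      exact three_force _ _ _ _ hTF hFB.symm hTB (by rw [← hP]; exact h1.symm) h3
    · have hP : κ (lvV v true) ≠ κ (spV 0) := by simpa using hev
      exact three_force _ _ _ _ hTF hFB.symm hTB hP h2
  refine ⟨σ, (CNF.eval_eq_true_iff _ _).2 fun C hC => ?_⟩
  obtain ⟨i, rfl⟩ := List.mem_ofFn.1 hC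
  by_contra hcl
  -- all three literals are false
  have hfalse : ∀ j' : Fin 3, Literal.eval σ (L i j') = false := by
    intro j'
    have h0 : Clause.eval σ (List.ofFn (L i)) = false := by simpa using hcl
    rw [Clause.eval, List.any_eq_false] at h0
    simpa using h0 (L i j') (List.mem_ofFn.2 ⟨j', rfl⟩)
  have hin : ∀ j' : Fin 3, κ (lvV ⟨(L i j').1, hL i j'⟩ (L i j').2) = κ (spV 1) := fun j' =>
    hlit ⟨(L i j').1, hL i j'⟩ (L i j').2 (hfalse j')
  -- input edges
  have hI : ∀ (j : Fin 6) (j' : Fin 3), inp j j' = true →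
      κ (gdV i j) ≠ κ (lvV ⟨(L i j').1, hL i j'⟩ (L i j').2) := fun j j' hj =>
    hadj (gdV i j) (lvV ⟨(L i j').1, hL i j'⟩ (L i j').2) ⟨j', hj, rfl⟩
  -- internal edges
  have hE : ∀ j j' : Fin 6, gadE j j' = true → κ (gdV i j) ≠ κ (gdV i j') := fun j j' hj =>
    hadj (gdV i j) (gdV i j') ⟨rfl, hj⟩
  have ho₁ : κ (gdV i 2) = κ (spV 1) :=
    three_force _ _ _ _ (by rw [← hin 0]; exact hI 0 0 (by decide))
      (by rw [← hin 1]; exact hI 1 1 (by decide)) (hE 0 1 (by decide)) (hE 0 2 (by decide)).symm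
      (hE 1 2 (by decide)).symm
  have ho₂ : κ (gdV i 5) = κ (spV 1) :=
    three_force _ _ _ _ (by rw [← ho₁]; exact (hE 2 3 (by decide)).symm)
      (by rw [← hin 2]; exact hI 4 2 (by decide)) (hE 3 4 (by decide)) (hE 3 5 (by decide)).symm
      (hE 4 5 (by decide)).symm
  exact hadj (gdV i 5) (spV 1) ⟨rfl, show (1 : Fin 3) ≠ 0 by decide⟩ ho₂


/-! ### Unsatisfiable expanding 3-CNFs exist (first moments) -/

/-- **Unsatisfiable cover-expanding 3-CNFs at density `6`.** There is `0 < κ ≤ 1` such that for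
all large `n` some tuple of `6n` clauses from `kClauses 3 n` lists an UNSATISFIABLE formula whose
scope family is a `(⌊κn⌋, 7/4)`-cover expander: both failure counts
(`card_le_of_forall_satisfiable`: a `(2 (7/8)^6)^n` fraction; 
`card_le_of_forall_not_isCoverExpander_linear`: a `32 a B⁴/n` fraction, `a = 7/4`,
`B = e^{11/4} · 6 · 7/4`, `κ = 1/(a (2B)^4)`) are eventually below `1/2` of all tuples.
[Chvátal–Szemerédi 1988, §1 and Lemma 1; Ben-Sasson–Wigderson 2001, §6]
[cite: ChvatalSzemeredi1988, §1 and Lemma 1] -/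
theorem exists_unsat_coverExpander :
    ∃ κ : ℝ, 0 < κ ∧ κ ≤ 1 ∧ ∃ n₀ : ℕ, ∀ n ≥ n₀, ∃ f : Fin (6 * n) → ↥(kClauses 3 n),
      ¬ CNF.Satisfiable (List.ofFn fun i => (f i : Clause ℕ)) ∧
      IsCoverExpander (fun i => clauseScope (f i : Clause ℕ)) ⌊κ * n⌋₊ (7 / 4) := by
  classical
  -- the constants of `chvatal_szemeredi_holds` at `k = 3`, density `6`
  set a : ℝ := (2 * (3 : ℕ) + 1) / 4 with ha
  set B : ℝ := Real.exp (1 + a) * (6 : ℕ) * a with hB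
  set κ : ℝ := 1 / (a * (2 * B) ^ 4) with hκ
  set ρ : ℝ := 2 * (1 - (1 / 2 : ℝ) ^ 3) ^ 6 with hρ
  have ha74 : a = 7 / 4 := by rw [ha]; norm_num
  have hapos : 0 < a := by rw [ha74]; norm_num
  have hBpos : 0 < B := by rw [hB]; positivity
  have h2B : (1 : ℝ) ≤ 2 * B := by
    rw [hB, ha74]
    have h1 : (1 : ℝ) ≤ Real.exp (1 + 7 / 4) := Real.one_le_exp (by norm_num)
    push_cast
    nlinarith
  have h2B4 : (1 : ℝ) ≤ (2 * B) ^ 4 := one_le_pow₀ h2B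
  have hκpos : 0 < κ := by rw [hκ]; positivity
  have hκ1 : κ ≤ 1 := by
    rw [hκ, div_le_one (by positivity), ha74]
    nlinarith
  have hρ0 : 0 ≤ ρ := by rw [hρ]; positivity
  have hρ1 : ρ < 1 := by rw [hρ]; norm_num
  -- the failure bound tends to `0`
  set β : ℕ → ℝ := fun n => ρ ^ n + 32 * a * B ^ 4 / n with hβ
  have hβlim : Tendsto β atTop (nhds 0) := by
    have h1 := tendsto_pow_atTop_nhds_zero_of_lt_one hρ0 hρ1
    have h2 := tendsto_const_div_atTop_nhds_zero_nat (32 * a * B ^ 4)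
    simpa using h1.add h2
  obtain ⟨n₁, hn₁⟩ := eventually_atTop.1 (hβlim.eventually (eventually_lt_nhds zero_lt_one))
  refine ⟨κ, hκpos, hκ1, max n₁ ⌈34 / κ⌉₊, fun n hn => ?_⟩
  have hβn : β n < 1 := hn₁ n (le_trans (le_max_left _ _) hn)
  have hn34 : ⌈(34 : ℝ) / κ⌉₊ ≤ n := le_trans (le_max_right _ _) hn
  have hκn : (34 : ℝ) ≤ κ * n := by
    have h1 : (34 : ℝ) / κ ≤ n := (Nat.le_ceil _).trans (by exact_mod_cast hn34)
    rwa [div_le_iff₀ hκpos, mul_comm] at h1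
  set N : ℕ := ⌊κ * n⌋₊ with hNdef
  have hNle : (N : ℝ) ≤ κ * n := Nat.floor_le (by positivity)
  have hnn : (0 : ℝ) ≤ n := Nat.cast_nonneg n
  have hn34' : (34 : ℝ) ≤ n := hκn.trans (by nlinarith)
  have hn1 : 1 ≤ n := by exact_mod_cast (show (1 : ℝ) ≤ n by linarith)
  have hkn : 3 ≤ n := by exact_mod_cast (show (3 : ℝ) ≤ n by linarith)
  have hK : (kClauses 3 n).Nonempty := by
    rw [← Finset.card_pos, card_kClauses]
    exact Nat.mul_pos (Nat.choose_pos hkn) (by positivity)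
  have haN : a * N ≤ n / (2 * B) ^ 4 := by
    calc a * N ≤ a * (κ * n) := mul_le_mul_of_nonneg_left hNle hapos.le
      _ = n / (2 * B) ^ 4 := by rw [hκ]; field_simp
  -- the bad tuples
  set badS : Finset (Fin (6 * n) → ↥(kClauses 3 n)) :=
    univ.filter fun g => CNF.Satisfiable (List.ofFn fun i => (g i : Clause ℕ)) with hbadS
  set badE : Finset (Fin (6 * n) → ↥(kClauses 3 n)) :=
    univ.filter fun g => ¬ IsCoverExpander (fun i => clauseScope (g i : Clause ℕ)) N a
    with hbadE
  have hS := card_le_of_forall_satisfiable badS (fun g hg => (mem_filter.1 hg).2)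
  norm_num at hS
  have hE := card_le_of_forall_not_isCoverExpander_linear (k := 3) (Δ := 6) (by norm_num)
    (by norm_num) hn1 hK ha hB haN badE (fun g hg => (mem_filter.1 hg).2)
  set T : ℝ := ((((kClauses 3 n).card ^ (6 * n) : ℕ)) : ℝ) with hT
  have hTpos : 0 < T := by
    rw [hT]
    exact_mod_cast pow_pos (Finset.card_pos.2 hK) _
  have hSr : (badS.card : ℝ) ≤ ρ ^ n * T := by
    have h1 : (badS.card : ℝ) ≤ 2 ^ n * ((n.choose 3 : ℝ) * 7) ^ (6 * n) := by
      exact_mod_cast hS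
    refine h1.trans (le_of_eq ?_)
    have hKc : ((kClauses 3 n).card : ℝ) = (n.choose 3 : ℝ) * 2 ^ 3 := by
      rw [card_kClauses]; push_cast; ring
    rw [hT]
    push_cast
    rw [hKc, hρ, pow_mul, pow_mul, ← mul_pow, ← mul_pow]
    congr 1
    ring
  have hlt : ((badS ∪ badE).card : ℝ) <
      (Finset.univ : Finset (Fin (6 * n) → ↥(kClauses 3 n))).card := by
    have huniv : ((Finset.univ : Finset (Fin (6 * n) → ↥(kClauses 3 n))).card : ℝ) = T := by
      rw [Finset.card_univ, Fintype.card_fun, Fintype.card_coe, Fintype.card_fin, hT]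
    rw [huniv]
    calc (((badS ∪ badE).card : ℕ) : ℝ) ≤ badS.card + badE.card := by
          exact_mod_cast Finset.card_union_le _ _
      _ ≤ ρ ^ n * T + 32 * a * B ^ 4 / n * T := add_le_add hSr hE
      _ = β n * T := by rw [hβ]; ring
      _ < 1 * T := mul_lt_mul_of_pos_right hβn hTpos
      _ = T := one_mul T
  obtain ⟨g, -, hg⟩ := Finset.exists_mem_notMem_of_card_lt_card
    (s := badS ∪ badE) (t := Finset.univ) (by exact_mod_cast hlt)
  rw [Finset.mem_union, not_or] at hg
  refine ⟨g, fun h => hg.1 (mem_filter.2 ⟨mem_univ _, h⟩), ?_⟩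
  by_contra h
  rw [← ha74] at h
  exact hg.2 (mem_filter.2 ⟨mem_univ _, h⟩)

end ThreeColGadget

open ThreeColGadget in
/-- **Linear-degree SOS lower bound for 3-colourability — proved** (the named fact
`SOSThreeColLinearLowerBound`: Thapper–Živný 2018, §3.3 Thm. 2 with Def. 12 for the template `K₃`;
Atserias–Ochremiak 2019, Cor. 5 (4) in primal form). With the `κ` of
`exists_unsat_coverExpander` and `c = κ/2000`: for every `n ≥ n₁` take `nv = ⌊n/40⌋` variables,
an unsatisfiable cover-expanding 3-CNF with `6 nv` clauses on them, its 3-colouring gadget graph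
(`3 + 2nv + 36nv ≤ n` vertices) padded with isolated vertices to exactly `n` vertices and renamed
to `Fin n`. It is not 3-colourable (`satisfiable_of_colorable`), and degree-`⌊cn⌋` SOS does not
refute it: cover expansion `7/4` at radius `N = ⌊κ nv⌋` ⇒ boundary expansion `1/2` ⇒ vector
expansion ⇒ the Grigoriev–Schoenebeck functional of degree `D = 3⌊cn⌋ + 3 ≤ N/4` ⇒ its
pushforward along the gadget interpretation (`sosFailsToRefuteThreeCol_gadGraph`).
[Thapper–Živný 2018, §3.3 Thm. 2, Def. 12–13, §4 Thm. 3; Atserias–Ochremiak 2019, §8.1 Cor. 5 (4),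
§8.2, §6.4; Grigoriev 2001; Schoenebeck 2008; Chvátal–Szemerédi 1988]
[cite: ThapperZivny2018, §3.3 Theorem thm:main with Definition 12] -/
theorem SOSThreeColLinearLowerBound_holds : SOSThreeColLinearLowerBound := by
  classical
  obtain ⟨κ, hκ, hκ1, n₀, hgood⟩ := exists_unsat_coverExpander
  refine ⟨κ / 2000, by positivity, ?_⟩
  refine eventually_atTop.2 ⟨40 * n₀ + 40 + ⌈(800 : ℝ) / κ⌉₊ + 120, fun n hn => ?_⟩
  -- sizes
  set nv : ℕ := n / 40 with hnvdef
  have hn0 : n₀ ≤ nv := by omega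
  have h800 : ⌈(800 : ℝ) / κ⌉₊ ≤ n := by omega
  have hκn : (800 : ℝ) ≤ κ * n := by
    have h1 : (800 : ℝ) / κ ≤ n := (Nat.le_ceil _).trans (by exact_mod_cast h800)
    rwa [div_le_iff₀ hκ, mul_comm] at h1
  have hnv : (n : ℝ) / 40 - 1 ≤ nv := by
    have h1 : n < n / 40 * 40 + 40 := Nat.lt_div_mul_add (by norm_num)
    have h2 : (n : ℝ) < (nv : ℝ) * 40 + 40 := by rw [hnvdef]; exact_mod_cast h1
    linarith
  obtain ⟨f, hunsat, hcov⟩ := hgood nv hn0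
  -- the literals of the clauses
  have hlen : ∀ i, ((f i : Clause ℕ)).length = 3 := fun i => length_of_mem_kClauses (f i).2
  set L : Fin (6 * nv) → Fin 3 → Literal ℕ := fun i j =>
    (f i : Clause ℕ)[j.val]'(by rw [hlen]; exact j.isLt) with hLdef
  have hfL : (fun i => (f i : Clause ℕ)) = fun i => List.ofFn (L i) := by
    funext i
    apply List.ext_getElem
    · rw [hlen, List.length_ofFn]
    · intro j h1 h2
      rw [List.getElem_ofFn]
  set φ : CNF ℕ := List.ofFn fun i => List.ofFn (L i) with hφdef
  have hφ : (List.ofFn fun i => (f i : Clause ℕ)) = φ := by rw [hfL]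
  have hL : ∀ i j, (L i j).1 < nv := by
    intro i j
    have hmem : L i j ∈ (f i : Clause ℕ) := List.getElem_mem _
    have h1 : (L i j).1 ∈ clauseScope (f i : Clause ℕ) := mem_clauseScope.2 ⟨(L i j).2, hmem⟩
    simpa using clauseScope_subset_range (f i).2 h1
  -- the vertex set has exactly `n` elements
  set pad : ℕ := n - (3 + 2 * nv + 36 * nv) with hpaddef
  have hcard : Fintype.card (Vtx nv (6 * nv) pad) = n := by
    rw [card_vtx]
    omega
  let e : Vtx nv (6 * nv) pad ≃ Fin n := Fintype.equivFinOfCardEq hcard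
  refine ⟨(gadGraph L).comap e.symm, ?_, ?_⟩
  · -- not 3-colourable
    intro hcol
    have hcol' : (gadGraph L : SimpleGraph (Vtx nv (6 * nv) pad)).Colorable 3 :=
      hcol.of_hom (SimpleGraph.Iso.comap e.symm (gadGraph L)).symm.toHom
    have hsat : CNF.Satisfiable φ := satisfiable_of_colorable L hL hcol'
    rw [← hφ] at hsat
    exact hunsat hsat
  · -- SOS of degree `⌊κ/2000 · n⌋` is fooled
    have hcov' : IsCoverExpander (cnfScopes φ) ⌊κ * nv⌋₊ (7 / 4) := by
      rw [← hφ]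
      exact hcov.cnfScopes_ofFn
    have hlen3 : ∀ C ∈ φ, C.length = 3 := by
      intro C hC
      obtain ⟨i, rfl⟩ := List.mem_ofFn.1 hC
      simp
    have hsc : ∀ i, (cnfScopes φ i).card ≤ 3 := fun i =>
      (card_clauseScope_le _).trans (hlen3 _ (List.getElem_mem ..)).le
    have hbd : IsBoundaryExpander (cnfScopes φ) ⌊κ * nv⌋₊ (1 / 2) := by
      refine IsCoverExpander.isBoundaryExpander (k := 3) hsc ?_
      norm_num
      exact hcov'
    have hnd : ∀ C ∈ φ, (C.map Prod.fst).Nodup := by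
      intro C hC
      rw [← hφ] at hC
      obtain ⟨i, rfl⟩ := List.mem_ofFn.1 hC
      exact nodup_map_fst_of_mem_kClauses (f i).2
    have hvec : VecExpands (cnfVecs φ) ⌊κ * nv⌋₊ (1 / 2) := by
      have h : cnfVecs φ = fun i => indVec (cnfScopes φ i) := by
        funext i
        exact clauseVec_eq_indVec (hnd _ (List.getElem_mem ..))
      rw [h]
      exact vecExpands_of_isBoundaryExpander hbd
    -- the degree arithmetic
    set d : ℕ := ⌊κ / 2000 * n⌋₊ with hddef
    have hdle : (d : ℝ) ≤ κ / 2000 * n := Nat.floor_le (by positivity)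
    have hNge : κ * nv - 1 < (⌊κ * nv⌋₊ : ℕ) := Nat.sub_one_lt_floor _
    have hκnv : κ * n / 40 - κ ≤ κ * nv := by
      have h := mul_le_mul_of_nonneg_left hnv hκ.le
      have h' : κ * ((n : ℝ) / 40 - 1) = κ * n / 40 - κ := by ring
      linarith
    have hr : (2 : ℝ) ≤ (⌊κ * nv⌋₊ : ℕ) := by linarith
    have hD : (((3 * d + 3 : ℕ)) : ℝ) ≤ 1 / 2 * (⌊κ * nv⌋₊ : ℕ) / 2 := by
      push_cast
      linarith
    exact sosFailsToRefuteThreeCol_gadGraph L hvec (by norm_num) hr hD le_rfl e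

end Literature.Computability.MetaComplexity
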